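import Summits.Langlands.Langlands.Theses.CMFreeCompletedClosure
import Literature.Algebra.Homology.GroupCohomologySemilinear

/-!
# Line `integral_family_split` for the crux `CMFreeCompletedClosure.Visibility` (stmt-Langlands-18470)

crux-strategist ALTERNATIVE line (registered with `--alt`; the birth skeleton `Lines/birth.lean`,
stubs `stub_visibility_regular` / `stub_irregular_congruences` / `stub_occurs_of_congruences`, stays the
live decomposition).  Card: `Lines/integral-family-split.md`.

Idea.  `Visibility` bundles two independent pieces of mathematics, and the birth skeleton's hardest stub
(`stub_irregular_congruences`) inherits both: (A) ARITHMETIC — the normalised Hecke eigenvalues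
`q_v^{-j(j-1)/2} e_j(α_v⁻¹)` of an L-algebraic cuspidal `π` are `ℓ`-integral under every `ι : ℚ̄_ℓ ≃ ℂ`
(over all `ι`: algebraic integers) off a finite set; (B) COHOMOLOGICAL — an `ℓ`-integral arithmetic
Satake family of automorphic origin occurs in / is an `ℓ`-adic limit of eigensystems occurring in the
completed cohomology of `GL_n/E` at a tame level containing the exceptional set.  This line cuts the
crux along BOTH axes (regular/irregular × integrality/occurrence): four stubs, two of them theorems in
print (regular sector), two open (irregular sector), composed by the PROVED closure lemma
`occurs_of_congruences` (= the birth stub `stub_occurs_of_congruences`, discharged here).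

Stubs (signatures are the child statements of the strategist's `children.json`):
* `stub_integralFamily_regular`   — Clozel 1990 Thm 3.13 + integrality of cuspidal cohomology (M–L).
* `stub_occursOfFamily_regular`   — Franke/Borel realisation + Emerton–Hochschild–Serre weight
  independence, eigenclass with exact annihilator `ℓ^{t+1}` at deep `ℓ`-power level (L–XL; BC5 rung:
  NON-CM totally complex `E`, where the summit is not known).
* `stub_integralFamily_irregular` — OPEN (contains algebraicity of Maass-`1/4` Hecke eigenvalues via
  quadratic base change; `Literature.Barriers.Langlands.NonRegularWeightBarrier`).
* `stub_occursOfFamily_irregular` — OPEN core (Calegari–Emerton visibility of irregular automorphic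
  eigensystems; torsion approximants allowed, `𝒰.bad ⊇ S`).
-/

noncomputable section

set_option linter.dupNamespace false

open CategoryTheory
open scoped NumberField

namespace Summit.Langlands.Langlands.Cruxes.Visibility.IntegralFamilySplit

open Literature.NumberTheory.Automorphic IsDedekindDomain

universe u

/-! ## Torsion glue: a scalar killing the coefficients kills group cohomology -/

section Torsion

variable {k : Type u} [CommRing k] {G : Type u} [Group G]

/-- If `r • a = 0` for every `a : A`, then `r • x = 0` for every `x ∈ Hⁿ(G, A)` (lift `x` to a cocycle
`z`, a function `Gⁿ → A`, on which `r` acts valuewise). [folklore] -/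
theorem smul_groupCohomology_eq_zero (A : Rep k G) (n : ℕ) {r : k} (hr : ∀ a : A, r • a = 0)
    (x : groupCohomology A n) : r • x = 0 := by
  obtain ⟨z, rfl⟩ := Literature.Algebra.Homology.π_surjective A n x
  have hz : r • z = 0 := by
    apply Literature.Algebra.Homology.iCocycles_injective A n
    rw [map_smul, map_zero]
    funext g
    exact hr _
  rw [← map_smul, hz, map_zero]

/-- A scalar in `I` kills `k ⧸ I`. [folklore] -/
theorem smul_quotient_eq_zero_of_mem {I : Ideal k} {r : k} (hr : r ∈ I) (m : k ⧸ I) : r • m = 0 := by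
  rw [Algebra.smul_def, Ideal.Quotient.algebraMap_eq, Ideal.Quotient.eq_zero_iff_mem.mpr hr, zero_mul]

/-- A scalar in `(ϖ^t)` kills `H^i(X_L, k/ϖ^t)` (cohomology of an arithmetic quotient with
`ϖ^t`-torsion coefficients). [folklore] -/
theorem smul_cohomology_modPow_eq_zero {Γ 𝒢 : Type u} [Group Γ] [Group 𝒢] (ι : Γ →* 𝒢)
    (L : Subgroup 𝒢) (ϖ : k) (t i : ℕ) {r : k} (hr : r ∈ Ideal.span {ϖ ^ t})
    (x : ArithmeticQuotient.cohomology k ι L (modPow k ϖ t) i) : r • x = 0 := by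
  refine smul_groupCohomology_eq_zero (ArithmeticQuotient.coeffRep k ι L (modPow k ϖ t)) i ?_ x
  intro f
  funext c
  exact smul_quotient_eq_zero_of_mem hr (f c)

end Torsion

/-! ## The closure stub of the birth skeleton, proved -/

/-- **`stub_occurs_of_congruences` (birth skeleton of `Visibility`), proved.**  If for every `t` some
eigensystem `b` occurring in `H̃^i` at tame level `𝒰` satisfies `a ≡ b (mod ℓ^{t+1})` valuewise, then
`a` occurs in `H̃^i` at tame level `𝒰`: the stage-`t` eigenclass of `b` is an eigenclass for `a`
(`smul_cohomology_modPow_eq_zero`). [folklore] -/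
theorem occurs_of_congruences : ∀ (E : Type) [Field E] [NumberField E] (n ℓ : ℕ) [Fact ℓ.Prime] (𝒰 : Literature.NumberTheory.Automorphic.BigHeckeGLn.TameLevel n E ℓ) (i : ℕ) (a : IsDedekindDomain.HeightOneSpectrum (NumberField.RingOfIntegers E) → ℕ → (Valued.v : Valuation (PadicAlgCl ℓ) NNReal).valuationSubring), (∀ t : ℕ, ∃ b : IsDedekindDomain.HeightOneSpectrum (NumberField.RingOfIntegers E) → ℕ → (Valued.v : Valuation (PadicAlgCl ℓ) NNReal).valuationSubring, 𝒰.EigensystemOccurs (Valued.v : Valuation (PadicAlgCl ℓ) NNReal).valuationSubring b i ∧ ∀ (v : IsDedekindDomain.HeightOneSpectrum (NumberField.RingOfIntegers E)) (j : ℕ), a v j - b v j ∈ Ideal.span {(((ℓ : ℕ) : (Valued.v : Valuation (PadicAlgCl ℓ) NNReal).valuationSubring)) ^ (t + 1)}) → 𝒰.EigensystemOccurs (Valued.v : Valuation (PadicAlgCl ℓ) NNReal).valuationSubring a i := by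
  intro E _ _ n ℓ _ 𝒰 i a h t
  obtain ⟨b, hb, hab⟩ := h t
  obtain ⟨s, c, ⟨hc0, hceig⟩, hann⟩ := hb t
  refine ⟨s, c, ⟨hc0, fun x => ?_⟩, hann⟩
  rw [hceig x]
  have hzero := smul_cohomology_modPow_eq_zero (BigHeckeGLn.globalEmbedding n E) (𝒰.tower s)
    (((ℓ : ℕ) : (Valued.v : Valuation (PadicAlgCl ℓ) NNReal).valuationSubring)) (t + 1) i
    (hab x.v x.i) c
  rw [sub_smul, sub_eq_zero] at hzero
  exact hzero.symm

/-! ## The four stubs -/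

/-- **Integral arithmetic Satake family, regular sector** (Clozel: `ℚ(π_f)` is a number field and the
cohomological twist has algebraic-integer Hecke eigenvalues). Size M–L. -/
theorem stub_integralFamily_regular :
    ∀ (E : Type) [Field E] [NumberField E], NumberField.IsTotallyComplex E → ∀ (n : ℕ), 0 < n → ∀ (hcpt : Literature.NumberTheory.Automorphic.isCompact_glFiniteIntegralLevel n E) (π : Literature.NumberTheory.Automorphic.CuspidalAutomorphicRepData n E hcpt), π.1.IsLAlgebraic → (∃ T : Literature.NumberTheory.Automorphic.InfinityType E n, π.1.HasInfinityType T ∧ T.IsLAlgebraic ∧ T.IsRegular) → ∀ (ℓ : ℕ) [Fact ℓ.Prime] (ι : PadicAlgCl ℓ ≃+* ℂ), ∃ (S : Finset (IsDedekindDomain.HeightOneSpectrum (NumberField.RingOfIntegers E))) (a : IsDedekindDomain.HeightOneSpectrum (NumberField.RingOfIntegers E) → ℕ → (Valued.v : Valuation (PadicAlgCl ℓ) NNReal).valuationSubring), ∀ v ∉ S, ∃ α : Multiset ℂ, π.1.HasSatakeParamAt v α ∧ Literature.NumberTheory.Automorphic.BigHeckeGLn.heckeFrobPoly n (Ideal.absNorm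 v.asIdeal) (fun j => ((a v j : (Valued.v : Valuation (PadicAlgCl ℓ) NNReal).valuationSubring) : PadicAlgCl ℓ)) = Literature.NumberTheory.Automorphic.arithFrobPolyOfSatake ι v.residueCard 1 α := by
  sorry

/-- **Occurrence of an integral family, regular sector** (Franke/Borel + Emerton weight independence;
exact annihilator from a primitive integral eigenclass). Size L–XL. The BC5 rung of the route. -/
theorem stub_occursOfFamily_regular :
    ∀ (E : Type) [Field E] [NumberField E], NumberField.IsTotallyComplex E → ∀ (n : ℕ), 0 < n → ∀ (hcpt : Literature.NumberTheory.Automorphic.isCompact_glFiniteIntegralLevel n E) (π : Literature.NumberTheory.Automorphic.CuspidalAutomorphicRepData n E hcpt), π.1.IsLAlgebraic → (∃ T : Literature.NumberTheory.Automorphic.InfinityType E n, π.1.HasInfinityType T ∧ T.IsLAlgebraic ∧ T.IsRegular) → ∀ (ℓ : ℕ) [Fact ℓ.Prime] (ι : PadicAlgCl ℓ ≃+* ℂ) (S : Finset (IsDedekindDomain.HeightOneSpectrum (NumberField.RingOfIntegers E))) (a : IsDedekindDomain.HeightOneSpectrum (NumberField.RingOfIntegers E) → ℕ → (Valued.v :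 Valuation (PadicAlgCl ℓ) NNReal).valuationSubring), (∀ v ∉ S, ∃ α : Multiset ℂ, π.1.HasSatakeParamAt v α ∧ Literature.NumberTheory.Automorphic.BigHeckeGLn.heckeFrobPoly n (Ideal.absNorm v.asIdeal) (fun j => ((a v j : (Valued.v : Valuation (PadicAlgCl ℓ) NNReal).valuationSubring) : PadicAlgCl ℓ)) = Literature.NumberTheory.Automorphic.arithFrobPolyOfSatake ι v.residueCard 1 α) → ∃ (𝒰 : Literature.NumberTheory.Automorphic.BigHeckeGLn.TameLevel n E ℓ) (i : ℕ), (∀ v ∈ S, v ∈ 𝒰.bad) ∧ 𝒰.EigensystemOccurs (Valued.v : Valuation (PadicAlgCl ℓ) NNReal).valuationSubring a i := by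
  sorry

/-- **Integral arithmetic Satake family, irregular sector** — OPEN (algebraic integrality of Satake
polynomials of non-cohomological L-algebraic `π`; Buzzard–Gee Conj. 3.1.6-type; for `n = 2` over an
imaginary quadratic field it contains the Maass-`1/4` algebraicity problem). -/
theorem stub_integralFamily_irregular :
    ∀ (E : Type) [Field E] [NumberField E], NumberField.IsTotallyComplex E → ∀ (n : ℕ), 0 < n → ∀ (hcpt : Literature.NumberTheory.Automorphic.isCompact_glFiniteIntegralLevel n E) (π : Literature.NumberTheory.Automorphic.CuspidalAutomorphicRepData n E hcpt), π.1.IsLAlgebraic → ¬ (∃ T : Literature.NumberTheory.Automorphic.InfinityType E n, π.1.HasInfinityType T ∧ T.IsLAlgebraic ∧ T.IsRegular) → ∀ (ℓ : ℕ) [Fact ℓ.Prime] (ι : PadicAlgCl ℓ ≃+* ℂ), ∃ (S : Finset (IsDedekindDomain.HeightOneSpectrum (NumberField.RingOfIntegers E))) (a : IsDedekindDomain.HeightOneSpectrum (NumberField.RingOfIntegers E) → ℕ → (Valued.v : Valuation (PadicAlgCl ℓ) NNReal).valuationSubring), ∀ v ∉ S, ∃ α : Multiset ℂ, π.1.HasSatakeParamAt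 v α ∧ Literature.NumberTheory.Automorphic.BigHeckeGLn.heckeFrobPoly n (Ideal.absNorm v.asIdeal) (fun j => ((a v j : (Valued.v : Valuation (PadicAlgCl ℓ) NNReal).valuationSubring) : PadicAlgCl ℓ)) = Literature.NumberTheory.Automorphic.arithFrobPolyOfSatake ι v.residueCard 1 α := by
  sorry

/-- **Occurrence of integral families as `ℓ`-adic limits, irregular sector** — OPEN core
(Calegari–Emerton: completed cohomology of `GL_n/E` sees every automorphic eigensystem; torsion
approximants `b_t`, tame level with `𝒰.bad ⊇ S`). -/
theorem stub_occursOfFamily_irregular :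
    ∀ (E : Type) [Field E] [NumberField E], NumberField.IsTotallyComplex E → ∀ (n : ℕ), 0 < n → ∀ (hcpt : Literature.NumberTheory.Automorphic.isCompact_glFiniteIntegralLevel n E) (π : Literature.NumberTheory.Automorphic.CuspidalAutomorphicRepData n E hcpt), π.1.IsLAlgebraic → ¬ (∃ T : Literature.NumberTheory.Automorphic.InfinityType E n, π.1.HasInfinityType T ∧ T.IsLAlgebraic ∧ T.IsRegular) → ∀ (ℓ : ℕ) [Fact ℓ.Prime] (ι : PadicAlgCl ℓ ≃+* ℂ) (S : Finset (IsDedekindDomain.HeightOneSpectrum (NumberField.RingOfIntegers E))) (a : IsDedekindDomain.HeightOneSpectrum (NumberField.RingOfIntegers E) → ℕ → (Valued.v : Valuation (PadicAlgCl ℓ) NNReal).valuationSubring), (∀ v ∉ S, ∃ α : Multiset ℂ, π.1.HasSatakeParamAt v α ∧ Literature.NumberTheory.Automorphic.BigHeckeGLn.heckeFrobPoly n (Ideal.absNorm v.asIdeal) (fun j => ((a v j : (Valued.v : Valuation (PadicAlgCl ℓ) NNReal).valuationSubring) : PadicAlgCl ℓ)) = Literature.NumberTheory.Automorphic.arithFrobPolyOfSatake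 ι v.residueCard 1 α) → ∃ (𝒰 : Literature.NumberTheory.Automorphic.BigHeckeGLn.TameLevel n E ℓ) (i : ℕ), (∀ v ∈ S, v ∈ 𝒰.bad) ∧ ∀ t : ℕ, ∃ b : IsDedekindDomain.HeightOneSpectrum (NumberField.RingOfIntegers E) → ℕ → (Valued.v : Valuation (PadicAlgCl ℓ) NNReal).valuationSubring, 𝒰.EigensystemOccurs (Valued.v : Valuation (PadicAlgCl ℓ) NNReal).valuationSubring b i ∧ ∀ (v : IsDedekindDomain.HeightOneSpectrum (NumberField.RingOfIntegers E)) (j : ℕ), a v j - b v j ∈ Ideal.span {(((ℓ : ℕ) : (Valued.v : Valuation (PadicAlgCl ℓ) NNReal).valuationSubring)) ^ (t + 1)} := by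
  sorry

/-! ## Composition -/

/-- **The line concludes the crux by name**: `stub₁ → stub₂ → stub₃ → stub₄ → Visibility`
(case split on regular L-algebraic, `∃ T, π.1.HasInfinityType T ∧ T.IsLAlgebraic ∧ T.IsRegular`; `occurs_of_congruences` turns the congruences of stub₄ into
occurrence; the Satake identity off `𝒰.bad ⊇ S` comes from the family). -/
theorem Visibility_of :
    (∀ (E : Type) [Field E] [NumberField E], NumberField.IsTotallyComplex E → ∀ (n : ℕ), 0 < n → ∀ (hcpt : Literature.NumberTheory.Automorphic.isCompact_glFiniteIntegralLevel n E) (π : Literature.NumberTheory.Automorphic.CuspidalAutomorphicRepData n E hcpt), π.1.IsLAlgebraic → (∃ T : Literature.NumberTheory.Automorphic.InfinityType E n, π.1.HasInfinityType T ∧ T.IsLAlgebraic ∧ T.IsRegular) → ∀ (ℓ : ℕ) [Fact ℓ.Prime] (ι : PadicAlgCl ℓ ≃+* ℂ), ∃ (S : Finset (IsDedekindDomain.HeightOneSpectrum (NumberField.RingOfIntegers E))) (a : IsDedekindDomain.HeightOneSpectrum (NumberField.RingOfIntegers E) → ℕ → (Valued.v : Valuation (PadicAlgCl ℓ) NNReal).valuationSubring),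 ∀ v ∉ S, ∃ α : Multiset ℂ, π.1.HasSatakeParamAt v α ∧ Literature.NumberTheory.Automorphic.BigHeckeGLn.heckeFrobPoly n (Ideal.absNorm v.asIdeal) (fun j => ((a v j : (Valued.v : Valuation (PadicAlgCl ℓ) NNReal).valuationSubring) : PadicAlgCl ℓ)) = Literature.NumberTheory.Automorphic.arithFrobPolyOfSatake ι v.residueCard 1 α) →
    (∀ (E : Type) [Field E] [NumberField E], NumberField.IsTotallyComplex E → ∀ (n : ℕ), 0 < n → ∀ (hcpt : Literature.NumberTheory.Automorphic.isCompact_glFiniteIntegralLevel n E) (π : Literature.NumberTheory.Automorphic.CuspidalAutomorphicRepData n E hcpt), π.1.IsLAlgebraic → (∃ T : Literature.NumberTheory.Automorphic.InfinityType E n, π.1.HasInfinityType T ∧ T.IsLAlgebraic ∧ T.IsRegular) → ∀ (ℓ : ℕ) [Fact ℓ.Prime] (ι : PadicAlgCl ℓ ≃+* ℂ) (S : Finset (IsDedekindDomain.HeightOneSpectrum (NumberField.RingOfIntegers E))) (a : IsDedekindDomain.HeightOneSpectrum (NumberField.RingOfIntegers E) → ℕ → (Valued.v : Valuation (PadicAlgCl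 ℓ) NNReal).valuationSubring), (∀ v ∉ S, ∃ α : Multiset ℂ, π.1.HasSatakeParamAt v α ∧ Literature.NumberTheory.Automorphic.BigHeckeGLn.heckeFrobPoly n (Ideal.absNorm v.asIdeal) (fun j => ((a v j : (Valued.v : Valuation (PadicAlgCl ℓ) NNReal).valuationSubring) : PadicAlgCl ℓ)) = Literature.NumberTheory.Automorphic.arithFrobPolyOfSatake ι v.residueCard 1 α) → ∃ (𝒰 : Literature.NumberTheory.Automorphic.BigHeckeGLn.TameLevel n E ℓ) (i : ℕ), (∀ v ∈ S, v ∈ 𝒰.bad) ∧ 𝒰.EigensystemOccurs (Valued.v : Valuation (PadicAlgCl ℓ) NNReal).valuationSubring a i) →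
    (∀ (E : Type) [Field E] [NumberField E], NumberField.IsTotallyComplex E → ∀ (n : ℕ), 0 < n → ∀ (hcpt : Literature.NumberTheory.Automorphic.isCompact_glFiniteIntegralLevel n E) (π : Literature.NumberTheory.Automorphic.CuspidalAutomorphicRepData n E hcpt), π.1.IsLAlgebraic → ¬ (∃ T : Literature.NumberTheory.Automorphic.InfinityType E n, π.1.HasInfinityType T ∧ T.IsLAlgebraic ∧ T.IsRegular) → ∀ (ℓ : ℕ) [Fact ℓ.Prime] (ι : PadicAlgCl ℓ ≃+* ℂ), ∃ (S : Finset (IsDedekindDomain.HeightOneSpectrum (NumberField.RingOfIntegers E))) (a : IsDedekindDomain.HeightOneSpectrum (NumberField.RingOfIntegers E) → ℕ → (Valued.v : Valuation (PadicAlgCl ℓ) NNReal).valuationSubring), ∀ v ∉ S, ∃ α : Multiset ℂ, π.1.HasSatakeParamAt v α ∧ Literature.NumberTheory.Automorphic.BigHeckeGLn.heckeFrobPoly n (Ideal.absNorm v.asIdeal) (fun j => ((a v j : (Valued.v : Valuation (PadicAlgCl ℓ) NNReal).valuationSubring) : PadicAlgCl ℓ)) = Literature.NumberTheory.Automorphic.arithFrobPolyOfSatake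 ι v.residueCard 1 α) →
    (∀ (E : Type) [Field E] [NumberField E], NumberField.IsTotallyComplex E → ∀ (n : ℕ), 0 < n → ∀ (hcpt : Literature.NumberTheory.Automorphic.isCompact_glFiniteIntegralLevel n E) (π : Literature.NumberTheory.Automorphic.CuspidalAutomorphicRepData n E hcpt), π.1.IsLAlgebraic → ¬ (∃ T : Literature.NumberTheory.Automorphic.InfinityType E n, π.1.HasInfinityType T ∧ T.IsLAlgebraic ∧ T.IsRegular) → ∀ (ℓ : ℕ) [Fact ℓ.Prime] (ι : PadicAlgCl ℓ ≃+* ℂ) (S : Finset (IsDedekindDomain.HeightOneSpectrum (NumberField.RingOfIntegers E))) (a : IsDedekindDomain.HeightOneSpectrum (NumberField.RingOfIntegers E) → ℕ → (Valued.v : Valuation (PadicAlgCl ℓ) NNReal).valuationSubring), (∀ v ∉ S, ∃ α : Multiset ℂ, π.1.HasSatakeParamAt v α ∧ Literature.NumberTheory.Automorphic.BigHeckeGLn.heckeFrobPoly n (Ideal.absNorm v.asIdeal) (fun j => ((a v j : (Valued.v : Valuation (PadicAlgCl ℓ) NNReal).valuationSubring) : PadicAlgCl ℓ)) = Literature.NumberTheory.Automorphic.arithFrobPolyOfSatake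 ι v.residueCard 1 α) → ∃ (𝒰 : Literature.NumberTheory.Automorphic.BigHeckeGLn.TameLevel n E ℓ) (i : ℕ), (∀ v ∈ S, v ∈ 𝒰.bad) ∧ ∀ t : ℕ, ∃ b : IsDedekindDomain.HeightOneSpectrum (NumberField.RingOfIntegers E) → ℕ → (Valued.v : Valuation (PadicAlgCl ℓ) NNReal).valuationSubring, 𝒰.EigensystemOccurs (Valued.v : Valuation (PadicAlgCl ℓ) NNReal).valuationSubring b i ∧ ∀ (v : IsDedekindDomain.HeightOneSpectrum (NumberField.RingOfIntegers E)) (j : ℕ), a v j - b v j ∈ Ideal.span {(((ℓ : ℕ) : (Valued.v : Valuation (PadicAlgCl ℓ) NNReal).valuationSubring)) ^ (t + 1)}) →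
      Summit.Langlands.Langlands.Theses.CMFreeCompletedClosure.Visibility := by
  intro h1 h2 h3 h4 E _ _ hE n hn hcpt π hπ ℓ _ ι
  by_cases hreg : (∃ T : Literature.NumberTheory.Automorphic.InfinityType E n, π.1.HasInfinityType T ∧ T.IsLAlgebraic ∧ T.IsRegular)
  · obtain ⟨S, a, ha⟩ := h1 E hE n hn hcpt π hπ hreg ℓ ι
    obtain ⟨𝒰, i, hS, hocc⟩ := h2 E hE n hn hcpt π hπ hreg ℓ ι S a ha
    exact ⟨𝒰, i, a, hocc, fun v hv => ha v fun hvS => hv (hS v hvS)⟩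
  · obtain ⟨S, a, ha⟩ := h3 E hE n hn hcpt π hπ hreg ℓ ι
    obtain ⟨𝒰, i, hS, hlim⟩ := h4 E hE n hn hcpt π hπ hreg ℓ ι S a ha
    exact ⟨𝒰, i, a, occurs_of_congruences E n ℓ 𝒰 i a hlim, fun v hv => ha v fun hvS => hv (hS v hvS)⟩

/-- The crux from the stubs, as a closed term (kernel check of the composition). -/
theorem Visibility_holds_of_stubs : Summit.Langlands.Langlands.Theses.CMFreeCompletedClosure.Visibility :=
  Visibility_of stub_integralFamily_regular stub_occursOfFamily_regular stub_integralFamily_irregular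
    stub_occursOfFamily_irregular

end Summit.Langlands.Langlands.Cruxes.Visibility.IntegralFamilySplit
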